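import Mathlib
import Summits.Ventures.HodgeRepro.Tier4.Line4.PoincareSummableOfDecay
import Summits.Ventures.HodgeRepro.Tier4.Line4.KernelL1

/-!
# Tier4/Line4/TailLayerCake — the TAIL of the geometric side at the level of RATIONAL POINTS: a threshold layer-cake, the
tail of the Poincaré series outside the main orbit, and the bound `‖J(f) − O_{o₀}(f)‖ ≤ K · e^{−(β−α) R}`

Blind re-derivation cell `pub-hodge-repro`, Tier 4 «PROVE THE STEP», LINE L4, seat t4-x2 (g4, reserve wall-breaker),
lead (R-26) S15038 on the finding S15033 (B)/(C): the per-orbit route to C-L4-TAIL ((S2′) orbit count + (S3) per-orbit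
decay) rests on a uniform count of the non-zero terms of every orbit sum that the tree does not have, and without it the
margin `β = 3 > α = 2 + ε` is lost (`3 − α < α`).  THIS MODULE is the assembly at the level of the rational points
`γ ∈ G(k)` themselves, which needs NO orbit count and spends the margin once.  Tree path
`lean/Summits/Ventures/HodgeRepro/Tier4/Line4/TailLayerCake.lean`.  0 print, no `def`.

THE MATHEMATICS.  Fix a test `f`, a size `d ≥ 0` on `G`, a decay `‖f z‖ ≤ C e^{−β d z}`, and the one-sided count of
rate `α < β` on a region `P` containing the support of `f` (the `hcount` of `poincareSummable_of_decay'`, the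
`SublevelCount` display with `P z = (z_f ∈ K_f)`).  If every rational point OUTSIDE the main orbit `o₀` that meets the
support at `(t, t′) ∈ cl D_T × cl D_{T′}` has size `≥ R` (the POINT form of the coset sparsity (S1)), then
`∑_{γ ∉ o₀} ‖f (t⁻¹ γ t′)‖ ≤ C · C′ e^α e^{−(β−α) R} / (1 − e^{α−β})` (§1–§2: the layer-cake from the threshold on),
hence `‖K_f(t, t′) − K_f^{o₀}(t, t′)‖ ≤` the same (§3, `K_f − K_f^{o₀} = ∑'_{γ ∉ o₀} f(t⁻¹ γ t′)`), hence
`‖J(f) − O_{o₀}(f)‖ ≤ (that) · μ_{T′}(D_{T′}) · μ_T(D_T)` (§4, the two `integral_sub`s on L4-p2's KernelL1 integrability,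
the Poincaré bound supplied by PoincareSummableOfDecay).  For a level family `f N` with the threshold `g N`, §4 gives
`∃ K, ∀ N, ‖J(f N) − O_{o₀}(f N)‖ ≤ K e^{−(β−α) g N}` — with `g N → ∞` and the `γ₀`-term bounded below (`hmain`),
`J(f N) ≠ 0` from some level on (the final step is L1-p4's half of the assembly, (R-26)).

* `sum_exp_le_of_count_threshold` — the layer-cake with a threshold `R`: `∑_{o ∈ t} e^{−β d o} ≤ C′ e^α e^{−(β−α)R}
  / (1 − e^{α−β})` when `R ≤ d o` on `t` (via `sum_exp_le_of_count` on the shifted size `max 0 (d − R)`).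
* `sum_norm_le_of_decay_count_threshold`, `summable_norm_tail_of_decay_count_threshold`,
  `norm_tsum_tail_le_of_decay_count_threshold` — the partial sums / the `tsum` of `‖f (x⁻¹ γ y)‖` over a set `A` of
  rational points on which the support has size `≥ R`.
* `kernel_sub_partialKernel_eq_tsum`, `norm_kernel_sub_partialKernel_le` — the kernel minus the main partial kernel.
* `norm_J_sub_orbital_le` — `‖J(f) − O_{o₀}(f)‖ ≤ C · C′ e^α e^{−(β−α)R} (1 − e^{α−β})⁻¹ · μ_{T′}(D_{T′}) · μ_T(D_T)`.
* `exists_norm_J_sub_orbital_le_family` — the family form with one constant `K`.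

Nothing here says anything about the status of the Hodge conjecture for CM abelian varieties, which is NOT proved
(HC_CM is NOT proved by anyone in this repository).
-/

set_option autoImplicit false

noncomputable section

namespace Summit.Ventures.HodgeRepro.Tier4.Line4

open MeasureTheory Topology Filter Summit.Ventures.HodgeRepro.Tier4.Common
  Summit.Ventures.HodgeRepro.Tier4.Line1 Summit.Ventures.HodgeRepro.Tier4.Line1.RTF

/-! ## 1. The layer-cake from a threshold on -/

section LayerCake

variable {ι : Type}

/-- **The layer-cake with a threshold**: if every `o ∈ t` has size `d o ≥ R` and the count `#{o ∈ t : d o ≤ T} ≤ C′ e^{α T}`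
holds, then `∑_{o ∈ t} e^{−β d o} ≤ C′ e^α · e^{−(β−α) R} / (1 − e^{α−β})` for `α < β`, `β ≥ 0` — `sum_exp_le_of_count`
applied to the shifted size `max 0 (d − R)`, whose count is `C′ e^{α R} e^{α T}`. -/
theorem sum_exp_le_of_count_threshold (d : ι → ℝ) {α β C' R : ℝ} (hαβ : α < β) (hβ : 0 ≤ β) (hC' : 0 ≤ C')
    (t : Finset ι) (hR : ∀ o ∈ t, R ≤ d o)
    (hcount : ∀ T : ℝ, ∃ s : Finset ι, (∀ o ∈ t, d o ≤ T → o ∈ s) ∧ (s.card : ℝ) ≤ C' * Real.exp (α * T)) :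
    ∑ o ∈ t, Real.exp (-(β * d o)) ≤
      C' * Real.exp α * Real.exp (-((β - α) * R)) * (1 - Real.exp (α - β))⁻¹ := by
  set d' : ι → ℝ := fun o => max 0 (d o - R) with hd'
  have hd'0 : ∀ o, 0 ≤ d' o := fun o => le_max_left _ _
  have hshift : ∀ T : ℝ, ∃ s : Finset ι, (∀ o ∈ t, d' o ≤ T → o ∈ s) ∧
      (s.card : ℝ) ≤ (C' * Real.exp (α * R)) * Real.exp (α * T) := by
    intro T
    obtain ⟨s, hs, hcard⟩ := hcount (T + R)
    refine ⟨s, fun o ho hoT => hs o ho ?_, ?_⟩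
    · have h1 : d o - R ≤ d' o := le_max_right _ _
      linarith
    · calc (s.card : ℝ) ≤ C' * Real.exp (α * (T + R)) := hcard
        _ = (C' * Real.exp (α * R)) * Real.exp (α * T) := by
            rw [mul_assoc, ← Real.exp_add]
            congr 2
            ring
  have hmain := sum_exp_le_of_count d' hd'0 hαβ hβ (by positivity) t hshift
  -- on `t`, `d o = d' o + R`
  have hsum : ∑ o ∈ t, Real.exp (-(β * d o)) = Real.exp (-(β * R)) * ∑ o ∈ t, Real.exp (-(β * d' o)) := by
    rw [Finset.mul_sum]
    refine Finset.sum_congr rfl fun o ho => ?_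
    have h1 : d' o = d o - R := max_eq_right (by linarith [hR o ho])
    rw [← Real.exp_add, h1]
    congr 1
    ring
  rw [hsum]
  calc Real.exp (-(β * R)) * ∑ o ∈ t, Real.exp (-(β * d' o))
      ≤ Real.exp (-(β * R)) * (C' * Real.exp (α * R) * Real.exp α * (1 - Real.exp (α - β))⁻¹) :=
        mul_le_mul_of_nonneg_left hmain (Real.exp_pos _).le
    _ = C' * Real.exp α * Real.exp (-((β - α) * R)) * (1 - Real.exp (α - β))⁻¹ := by
        have h2 : Real.exp (-(β * R)) * Real.exp (α * R) = Real.exp (-((β - α) * R)) := by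
          rw [← Real.exp_add]
          congr 1
          ring
        calc Real.exp (-(β * R)) * (C' * Real.exp (α * R) * Real.exp α * (1 - Real.exp (α - β))⁻¹)
            = C' * Real.exp α * (Real.exp (-(β * R)) * Real.exp (α * R)) * (1 - Real.exp (α - β))⁻¹ := by ring
          _ = C' * Real.exp α * Real.exp (-((β - α) * R)) * (1 - Real.exp (α - β))⁻¹ := by rw [h2]

end LayerCake

/-! ## 2. The tail of the Poincaré series over a set of rational points of size `≥ R` -/

section Tail

variable {G : Type} [Group G] [TopologicalSpace G] [MeasurableSpace G] (S : Setting G)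

/-- **Partial sums over rational points of size `≥ R`**: for `f` with the decay `‖f z‖ ≤ C e^{−β d z}`, a count of rate
`α < β` at `(x, y)` on the support, and a finite set `t` of rational points whose support points have size `≥ R`
(`f (x⁻¹ γ y) ≠ 0 → R ≤ d (x⁻¹ γ y)` on `t`): `∑_{γ ∈ t} ‖f (x⁻¹ γ y)‖ ≤ C · C′ e^α e^{−(β−α)R} (1 − e^{α−β})⁻¹`. -/
theorem sum_norm_le_of_decay_count_threshold (f : G → ℂ) (d : G → ℝ) {C α β C' R : ℝ} (hC : 0 ≤ C)
    (hαβ : α < β) (hβ : 0 ≤ β) (hC' : 0 ≤ C') (hdecay : ∀ z, ‖f z‖ ≤ C * Real.exp (-(β * d z))) (x y : G)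
    (hcnt : ∀ T : ℝ, ∃ s : Finset S.Gk, (∀ γ : S.Gk, f (x⁻¹ * γ * y) ≠ 0 → d (x⁻¹ * γ * y) ≤ T → γ ∈ s) ∧
      (s.card : ℝ) ≤ C' * Real.exp (α * T))
    (t : Finset S.Gk) (hR : ∀ γ ∈ t, f (x⁻¹ * γ * y) ≠ 0 → R ≤ d (x⁻¹ * γ * y)) :
    ∑ γ ∈ t, ‖f (x⁻¹ * γ * y)‖ ≤
      C * (C' * Real.exp α * Real.exp (-((β - α) * R)) * (1 - Real.exp (α - β))⁻¹) := by
  classical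
  have hsum : ∑ γ ∈ t, ‖f (x⁻¹ * γ * y)‖ =
      ∑ γ ∈ t.filter (fun γ : S.Gk => f (x⁻¹ * γ * y) ≠ 0), ‖f (x⁻¹ * γ * y)‖ := by
    rw [Finset.sum_filter_of_ne]
    intro γ _ hne h0
    exact hne (by rw [h0, norm_zero])
  rw [hsum]
  calc ∑ γ ∈ t.filter (fun γ : S.Gk => f (x⁻¹ * γ * y) ≠ 0), ‖f (x⁻¹ * γ * y)‖
      ≤ ∑ γ ∈ t.filter (fun γ : S.Gk => f (x⁻¹ * γ * y) ≠ 0), C * Real.exp (-(β * d (x⁻¹ * γ * y))) :=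
        Finset.sum_le_sum fun γ _ => hdecay _
    _ = C * ∑ γ ∈ t.filter (fun γ : S.Gk => f (x⁻¹ * γ * y) ≠ 0), Real.exp (-(β * d (x⁻¹ * γ * y))) := by
        rw [Finset.mul_sum]
    _ ≤ C * (C' * Real.exp α * Real.exp (-((β - α) * R)) * (1 - Real.exp (α - β))⁻¹) := by
        refine mul_le_mul_of_nonneg_left ?_ hC
        refine sum_exp_le_of_count_threshold (fun γ : S.Gk => d (x⁻¹ * γ * y)) hαβ hβ hC' _ ?_ ?_
        · intro γ hγ
          rw [Finset.mem_filter] at hγ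
          exact hR γ hγ.1 hγ.2
        · intro T
          obtain ⟨s, hs, hcard⟩ := hcnt T
          refine ⟨s, fun γ hγ hdT => ?_, hcard⟩
          rw [Finset.mem_filter] at hγ
          exact hs γ hγ.2 hdT

/-- **The tail over a set `A` of rational points**: under the same decay and count, if the support points of `f` in `A`
have size `≥ R`, the family `γ ↦ ‖f (x⁻¹ γ y)‖` over `A` is summable with sum `≤ C · C′ e^α e^{−(β−α)R} (1 − e^{α−β})⁻¹`. -/
theorem summable_norm_tail_of_decay_count_threshold (f : G → ℂ) (d : G → ℝ) {C α β C' R : ℝ} (hC : 0 ≤ C)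
    (hαβ : α < β) (hβ : 0 ≤ β) (hC' : 0 ≤ C') (hdecay : ∀ z, ‖f z‖ ≤ C * Real.exp (-(β * d z))) (x y : G)
    (hcnt : ∀ T : ℝ, ∃ s : Finset S.Gk, (∀ γ : S.Gk, f (x⁻¹ * γ * y) ≠ 0 → d (x⁻¹ * γ * y) ≤ T → γ ∈ s) ∧
      (s.card : ℝ) ≤ C' * Real.exp (α * T))
    (A : Set S.Gk) (hR : ∀ γ ∈ A, f (x⁻¹ * γ * y) ≠ 0 → R ≤ d (x⁻¹ * γ * y)) :
    Summable (fun γ : A => ‖f (x⁻¹ * γ.1 * y)‖) ∧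
      ∑' γ : A, ‖f (x⁻¹ * γ.1 * y)‖ ≤
        C * (C' * Real.exp α * Real.exp (-((β - α) * R)) * (1 - Real.exp (α - β))⁻¹) := by
  classical
  have key : ∀ t : Finset A, ∑ γ ∈ t, ‖f (x⁻¹ * γ.1 * y)‖ ≤
      C * (C' * Real.exp α * Real.exp (-((β - α) * R)) * (1 - Real.exp (α - β))⁻¹) := by
    intro t
    have h := sum_norm_le_of_decay_count_threshold S f d hC hαβ hβ hC' hdecay x y hcnt
      (t.map (Function.Embedding.subtype _)) (fun γ hγ => by
        obtain ⟨γ', -, rfl⟩ := Finset.mem_map.1 hγ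
        exact hR γ' γ'.2)
    rw [Finset.sum_map] at h
    exact h
  exact ⟨summable_of_sum_le (fun _ => norm_nonneg _) key, Real.tsum_le_of_sum_le (fun _ => norm_nonneg _) key⟩

/-- The norm of the tail sum `∑'_{γ ∈ A} f (x⁻¹ γ y)` is bounded by the same constant. -/
theorem norm_tsum_tail_le_of_decay_count_threshold (f : G → ℂ) (d : G → ℝ) {C α β C' R : ℝ} (hC : 0 ≤ C)
    (hαβ : α < β) (hβ : 0 ≤ β) (hC' : 0 ≤ C') (hdecay : ∀ z, ‖f z‖ ≤ C * Real.exp (-(β * d z))) (x y : G)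
    (hcnt : ∀ T : ℝ, ∃ s : Finset S.Gk, (∀ γ : S.Gk, f (x⁻¹ * γ * y) ≠ 0 → d (x⁻¹ * γ * y) ≤ T → γ ∈ s) ∧
      (s.card : ℝ) ≤ C' * Real.exp (α * T))
    (A : Set S.Gk) (hR : ∀ γ ∈ A, f (x⁻¹ * γ * y) ≠ 0 → R ≤ d (x⁻¹ * γ * y)) :
    ‖∑' γ : A, f (x⁻¹ * γ.1 * y)‖ ≤
      C * (C' * Real.exp α * Real.exp (-((β - α) * R)) * (1 - Real.exp (α - β))⁻¹) := by
  obtain ⟨hs, hle⟩ := summable_norm_tail_of_decay_count_threshold S f d hC hαβ hβ hC' hdecay x y hcnt A hR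
  exact (norm_tsum_le_tsum_norm hs).trans hle

end Tail

/-! ## 3. The kernel minus the main partial kernel -/

section Kernel

variable {G : Type} [Group G] [TopologicalSpace G] [MeasurableSpace G] (S : Setting G)

/-- `K_f(x, y) − K_f^{o₀}(x, y) = ∑'_{γ ∉ o₀} f (x⁻¹ γ y)` for an absolutely summable family. -/
theorem kernel_sub_partialKernel_eq_tsum {f : G → ℂ} {x y : G}
    (hs : Summable (fun γ : S.Gk => ‖f (x⁻¹ * γ * y)‖)) (o₀ : S.Orbit) :
    S.kernel f x y - S.partialKernel o₀ f x y =
      ∑' γ : ({γ : S.Gk | S.orbitOf γ = o₀}ᶜ : Set S.Gk), f (x⁻¹ * γ.1 * y) := by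
  have h := hs.of_norm.tsum_subtype_add_tsum_subtype_compl {γ : S.Gk | S.orbitOf γ = o₀}
  rw [sub_eq_iff_eq_add']
  exact h.symm

/-- `‖K_f(x, y) − K_f^{o₀}(x, y)‖ ≤ C · C′ e^α e^{−(β−α)R} (1 − e^{α−β})⁻¹` when every support point outside `o₀` at `(x, y)`
has size `≥ R`. -/
theorem norm_kernel_sub_partialKernel_le (f : G → ℂ) (d : G → ℝ) (hd : ∀ z, 0 ≤ d z) {C α β C' R : ℝ} (hC : 0 ≤ C)
    (hαβ : α < β) (hβ : 0 ≤ β) (hC' : 0 ≤ C') (hdecay : ∀ z, ‖f z‖ ≤ C * Real.exp (-(β * d z))) (x y : G)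
    (hcnt : ∀ T : ℝ, ∃ s : Finset S.Gk, (∀ γ : S.Gk, f (x⁻¹ * γ * y) ≠ 0 → d (x⁻¹ * γ * y) ≤ T → γ ∈ s) ∧
      (s.card : ℝ) ≤ C' * Real.exp (α * T))
    (o₀ : S.Orbit) (hR : ∀ γ : S.Gk, S.orbitOf γ ≠ o₀ → f (x⁻¹ * γ * y) ≠ 0 → R ≤ d (x⁻¹ * γ * y)) :
    ‖S.kernel f x y - S.partialKernel o₀ f x y‖ ≤
      C * (C' * Real.exp α * Real.exp (-((β - α) * R)) * (1 - Real.exp (α - β))⁻¹) := by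
  have hs : Summable (fun γ : S.Gk => ‖f (x⁻¹ * γ * y)‖) :=
    summable_of_sum_le (fun _ => norm_nonneg _)
      (sum_norm_le_of_decay_count S f d hd hC hαβ hβ hC' hdecay x y hcnt)
  rw [kernel_sub_partialKernel_eq_tsum S hs o₀]
  exact norm_tsum_tail_le_of_decay_count_threshold S f d hC hαβ hβ hC' hdecay x y hcnt _
    (fun γ hγ => hR γ hγ)

end Kernel

/-! ## 4. The tail of the geometric side: `‖J(f) − O_{o₀}(f)‖` -/

section Geometric

variable {G : Type} [Group G] [TopologicalSpace G] [IsTopologicalGroup G] [MeasurableSpace G] [BorelSpace G]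
  (S : Setting G) [SecondCountableTopology G] [Countable S.Gk]

/-- **The tail of the geometric side at the level of rational points**: for a continuous test `f` with the decay
`‖f z‖ ≤ C e^{−β d z}`, the one-sided count of rate `α < β` on a region `P ⊇ supp f` uniformly on compact pairs (the
`SublevelCount` shape), and every rational point outside `o₀` meeting the support at `(t, t′) ∈ cl D_T × cl D_{T′}` of
size `≥ R`: `‖J(f) − O_{o₀}(f)‖ ≤ C · C′ e^α e^{−(β−α)R} (1 − e^{α−β})⁻¹ · μ_{T′}(D_{T′}) · μ_T(D_T)`, where `C′` is the
count constant of the compact pair `cl D_T × cl D_{T′}`. -/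
theorem norm_J_sub_orbital_le (f : G → ℂ) (hf : Continuous f) (d : G → ℝ) (hd : ∀ z, 0 ≤ d z) {C α β : ℝ}
    (hC : 0 ≤ C) (hαβ : α < β) (hβ : 0 ≤ β) (hdecay : ∀ z, ‖f z‖ ≤ C * Real.exp (-(β * d z)))
    (P : G → Prop) (hsupp : ∀ z, f z ≠ 0 → P z)
    (hcount : ∀ C₁ C₂ : Set G, IsCompact C₁ → IsCompact C₂ → ∃ C' : ℝ, 0 ≤ C' ∧ ∀ x ∈ C₁, ∀ y ∈ C₂, ∀ T : ℝ,
      ∃ s : Finset S.Gk, (∀ γ : S.Gk, P (x⁻¹ * γ * y) → d (x⁻¹ * γ * y) ≤ T → γ ∈ s) ∧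
        (s.card : ℝ) ≤ C' * Real.exp (α * T))
    {χ : S.T → ℂ} (hχ : Continuous χ) (hu : ∀ a, ‖χ a‖ = 1) {χ' : S.T' → ℂ} (hχ' : Continuous χ')
    (hu' : ∀ a, ‖χ' a‖ = 1) (o₀ : S.Orbit) {R : ℝ}
    (hR : ∀ t ∈ closure S.DT, ∀ t' ∈ closure S.DT', ∀ γ : S.Gk, S.orbitOf γ ≠ o₀ →
      f ((t : G)⁻¹ * γ * t') ≠ 0 → R ≤ d ((t : G)⁻¹ * γ * t')) :
    ∃ C' : ℝ, 0 ≤ C' ∧ ‖S.J χ χ' f - S.orbital χ χ' o₀ f‖ ≤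
      C * (C' * Real.exp α * Real.exp (-((β - α) * R)) * (1 - Real.exp (α - β))⁻¹) *
        S.μT'.real S.DT' * S.μT.real S.DT := by
  -- the count on the support, from the count on the region
  have hcount' : ∀ C₁ C₂ : Set G, IsCompact C₁ → IsCompact C₂ → ∃ C' : ℝ, 0 ≤ C' ∧ ∀ x ∈ C₁, ∀ y ∈ C₂, ∀ T : ℝ,
      ∃ s : Finset S.Gk, (∀ γ : S.Gk, f (x⁻¹ * γ * y) ≠ 0 → d (x⁻¹ * γ * y) ≤ T → γ ∈ s) ∧
        (s.card : ℝ) ≤ C' * Real.exp (α * T) := by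
    intro C₁ C₂ hC₁ hC₂
    obtain ⟨C', hC'0, h⟩ := hcount C₁ C₂ hC₁ hC₂
    refine ⟨C', hC'0, fun x hx y hy T => ?_⟩
    obtain ⟨s, hs, hcard⟩ := h x hx y hy T
    exact ⟨s, fun γ hne hdT => hs γ (hsupp _ hne) hdT, hcard⟩
  -- the Poincaré bound of PoincareSummableOfDecay
  have hP : L1Class.PoincareSummable S f :=
    poincareSummable_of_decay_count S f d hd hC hαβ hβ hdecay hcount'
  -- the compact images of the closures of the toric domains
  set K₁ : Set G := (fun t : S.T => (t : G)) '' closure S.DT with hK₁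
  set K₂ : Set G := (fun t : S.T' => (t : G)) '' closure S.DT' with hK₂
  have hK₁c : IsCompact K₁ := S.compT.image continuous_subtype_val
  have hK₂c : IsCompact K₂ := S.compT'.image continuous_subtype_val
  obtain ⟨C', hC'0, hcnt⟩ := hcount' K₁ K₂ hK₁c hK₂c
  refine ⟨C', hC'0, ?_⟩
  set B : ℝ := C * (C' * Real.exp α * Real.exp (-((β - α) * R)) * (1 - Real.exp (α - β))⁻¹) with hB
  -- the pointwise bound on the closures
  have hpt : ∀ t ∈ closure S.DT, ∀ t' ∈ closure S.DT',
      ‖S.kernel f t t' - S.partialKernel o₀ f t t'‖ ≤ B :=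
    fun t ht t' ht' => norm_kernel_sub_partialKernel_le S f d hd hC hαβ hβ hC'0 hdecay _ _
      (hcnt _ ⟨t, ht, rfl⟩ _ ⟨t', ht', rfl⟩) o₀ (fun γ hγ hne => hR t ht t' ht' γ hγ hne)
  -- the inner integrals
  have hinner : ∀ t ∈ closure S.DT,
      ‖(∫ t' in S.DT', S.kernel f t t' * χ t * starRingEnd ℂ (χ' t') ∂S.μT') -
        ∫ t' in S.DT', S.partialKernel o₀ f t t' * χ t * starRingEnd ℂ (χ' t') ∂S.μT'‖ ≤
        B * S.μT'.real S.DT' := by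
    intro t ht
    rw [← integral_sub (integrableOn_kernel_mul_DT' S hf hP χ hχ' hu' ht)
      (integrableOn_partialKernel_mul_DT' S hf hP o₀ χ hχ' hu' ht)]
    refine norm_setIntegral_le_of_norm_le_const (measure_DT'_lt_top S) fun t' ht' => ?_
    have heq : S.kernel f t t' * χ t * starRingEnd ℂ (χ' t') -
        S.partialKernel o₀ f t t' * χ t * starRingEnd ℂ (χ' t') =
        (S.kernel f t t' - S.partialKernel o₀ f t t') * χ t * starRingEnd ℂ (χ' t') := by ring
    rw [heq, norm_mul, norm_mul, hu t, Complex.norm_conj, hu' t', mul_one, mul_one]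
    exact hpt t ht t' (subset_closure ht')
  -- the outer integral
  have houter := integral_sub (integrableOn_integral_kernel_mul_DT S hf hP hχ hu hχ' hu')
    (integrableOn_integral_partialKernel_mul_DT S hf hP o₀ hχ hu hχ' hu')
  change ‖(∫ t in S.DT, ∫ t' in S.DT', S.kernel f t t' * χ t * starRingEnd ℂ (χ' t') ∂S.μT' ∂S.μT) -
    ∫ t in S.DT, ∫ t' in S.DT', S.partialKernel o₀ f t t' * χ t * starRingEnd ℂ (χ' t') ∂S.μT' ∂S.μT‖ ≤ _
  rw [← houter]
  refine norm_setIntegral_le_of_norm_le_const (measure_DT_lt_top S) fun t ht => ?_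
  exact hinner t (subset_closure ht)

/-- **The family form**: for a level family `f N` with decay, region and count uniform in `N`, and the threshold
`g N` on the support outside `o₀` (the point form of the coset sparsity), ONE constant `K` with
`‖J(f N) − O_{o₀}(f N)‖ ≤ K · e^{−(β−α) g N}` for every `N`. -/
theorem exists_norm_J_sub_orbital_le_family (f : ℕ → G → ℂ) (hf : ∀ N, Continuous (f N)) (d : G → ℝ)
    (hd : ∀ z, 0 ≤ d z) {C α β : ℝ} (hC : 0 ≤ C) (hαβ : α < β) (hβ : 0 ≤ β)
    (hdecay : ∀ N z, ‖f N z‖ ≤ C * Real.exp (-(β * d z)))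
    (P : G → Prop) (hsupp : ∀ N z, f N z ≠ 0 → P z)
    (hcount : ∀ C₁ C₂ : Set G, IsCompact C₁ → IsCompact C₂ → ∃ C' : ℝ, 0 ≤ C' ∧ ∀ x ∈ C₁, ∀ y ∈ C₂, ∀ T : ℝ,
      ∃ s : Finset S.Gk, (∀ γ : S.Gk, P (x⁻¹ * γ * y) → d (x⁻¹ * γ * y) ≤ T → γ ∈ s) ∧
        (s.card : ℝ) ≤ C' * Real.exp (α * T))
    {χ : S.T → ℂ} (hχ : Continuous χ) (hu : ∀ a, ‖χ a‖ = 1) {χ' : S.T' → ℂ} (hχ' : Continuous χ')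
    (hu' : ∀ a, ‖χ' a‖ = 1) (o₀ : S.Orbit) (g : ℕ → ℝ)
    (hR : ∀ N, ∀ t ∈ closure S.DT, ∀ t' ∈ closure S.DT', ∀ γ : S.Gk, S.orbitOf γ ≠ o₀ →
      f N ((t : G)⁻¹ * γ * t') ≠ 0 → g N ≤ d ((t : G)⁻¹ * γ * t')) :
    ∃ K : ℝ, 0 ≤ K ∧ ∀ N, ‖S.J χ χ' (f N) - S.orbital χ χ' o₀ (f N)‖ ≤ K * Real.exp (-((β - α) * g N)) := by
  set K₁ : Set G := (fun t : S.T => (t : G)) '' closure S.DT with hK₁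
  set K₂ : Set G := (fun t : S.T' => (t : G)) '' closure S.DT' with hK₂
  obtain ⟨C', hC'0, hcnt⟩ := hcount K₁ K₂ (S.compT.image continuous_subtype_val)
    (S.compT'.image continuous_subtype_val)
  refine ⟨C * (C' * Real.exp α * (1 - Real.exp (α - β))⁻¹) * S.μT'.real S.DT' * S.μT.real S.DT, ?_, fun N => ?_⟩
  · have hr1 : Real.exp (α - β) < 1 := by
      rw [Real.exp_lt_one_iff]
      linarith
    have : 0 ≤ (1 - Real.exp (α - β))⁻¹ := inv_nonneg.2 (by linarith)
    positivity
  · -- the single-`f` bound with the count constant of the closures made explicit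
    have hcount₁ : ∀ C₁ C₂ : Set G, IsCompact C₁ → IsCompact C₂ → ∃ C'' : ℝ, 0 ≤ C'' ∧ ∀ x ∈ C₁, ∀ y ∈ C₂,
        ∀ T : ℝ, ∃ s : Finset S.Gk, (∀ γ : S.Gk, P (x⁻¹ * γ * y) → d (x⁻¹ * γ * y) ≤ T → γ ∈ s) ∧
          (s.card : ℝ) ≤ C'' * Real.exp (α * T) := hcount
    -- re-run the single-`f` argument with THIS `C'` (the proof of `norm_J_sub_orbital_le` at the closures)
    have hcount' : ∀ x ∈ K₁, ∀ y ∈ K₂, ∀ T : ℝ,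
        ∃ s : Finset S.Gk, (∀ γ : S.Gk, f N (x⁻¹ * γ * y) ≠ 0 → d (x⁻¹ * γ * y) ≤ T → γ ∈ s) ∧
          (s.card : ℝ) ≤ C' * Real.exp (α * T) := by
      intro x hx y hy T
      obtain ⟨s, hs, hcard⟩ := hcnt x hx y hy T
      exact ⟨s, fun γ hne hdT => hs γ (hsupp N _ hne) hdT, hcard⟩
    have hcountN : ∀ C₁ C₂ : Set G, IsCompact C₁ → IsCompact C₂ → ∃ C'' : ℝ, 0 ≤ C'' ∧ ∀ x ∈ C₁, ∀ y ∈ C₂,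
        ∀ T : ℝ, ∃ s : Finset S.Gk, (∀ γ : S.Gk, f N (x⁻¹ * γ * y) ≠ 0 → d (x⁻¹ * γ * y) ≤ T → γ ∈ s) ∧
          (s.card : ℝ) ≤ C'' * Real.exp (α * T) := by
      intro C₁ C₂ hC₁ hC₂
      obtain ⟨C'', hC''0, h⟩ := hcount₁ C₁ C₂ hC₁ hC₂
      refine ⟨C'', hC''0, fun x hx y hy T => ?_⟩
      obtain ⟨s, hs, hcard⟩ := h x hx y hy T
      exact ⟨s, fun γ hne hdT => hs γ (hsupp N _ hne) hdT, hcard⟩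
    have hP : L1Class.PoincareSummable S (f N) :=
      poincareSummable_of_decay_count S (f N) d hd hC hαβ hβ (hdecay N) hcountN
    set B : ℝ := C * (C' * Real.exp α * Real.exp (-((β - α) * g N)) * (1 - Real.exp (α - β))⁻¹) with hB
    have hpt : ∀ t ∈ closure S.DT, ∀ t' ∈ closure S.DT',
        ‖S.kernel (f N) t t' - S.partialKernel o₀ (f N) t t'‖ ≤ B :=
      fun t ht t' ht' => norm_kernel_sub_partialKernel_le S (f N) d hd hC hαβ hβ hC'0 (hdecay N) _ _
        (hcount' _ ⟨t, ht, rfl⟩ _ ⟨t', ht', rfl⟩) o₀ (fun γ hγ hne => hR N t ht t' ht' γ hγ hne)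
    have hinner : ∀ t ∈ closure S.DT,
        ‖(∫ t' in S.DT', S.kernel (f N) t t' * χ t * starRingEnd ℂ (χ' t') ∂S.μT') -
          ∫ t' in S.DT', S.partialKernel o₀ (f N) t t' * χ t * starRingEnd ℂ (χ' t') ∂S.μT'‖ ≤
          B * S.μT'.real S.DT' := by
      intro t ht
      rw [← integral_sub (integrableOn_kernel_mul_DT' S (hf N) hP χ hχ' hu' ht)
        (integrableOn_partialKernel_mul_DT' S (hf N) hP o₀ χ hχ' hu' ht)]
      refine norm_setIntegral_le_of_norm_le_const (measure_DT'_lt_top S) fun t' ht' => ?_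
      have heq : S.kernel (f N) t t' * χ t * starRingEnd ℂ (χ' t') -
          S.partialKernel o₀ (f N) t t' * χ t * starRingEnd ℂ (χ' t') =
          (S.kernel (f N) t t' - S.partialKernel o₀ (f N) t t') * χ t * starRingEnd ℂ (χ' t') := by ring
      rw [heq, norm_mul, norm_mul, hu t, Complex.norm_conj, hu' t', mul_one, mul_one]
      exact hpt t ht t' (subset_closure ht')
    have houter := integral_sub (integrableOn_integral_kernel_mul_DT S (hf N) hP hχ hu hχ' hu')
      (integrableOn_integral_partialKernel_mul_DT S (hf N) hP o₀ hχ hu hχ' hu')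
    change ‖(∫ t in S.DT, ∫ t' in S.DT', S.kernel (f N) t t' * χ t * starRingEnd ℂ (χ' t') ∂S.μT' ∂S.μT) -
      ∫ t in S.DT, ∫ t' in S.DT', S.partialKernel o₀ (f N) t t' * χ t * starRingEnd ℂ (χ' t') ∂S.μT' ∂S.μT‖ ≤ _
    rw [← houter]
    have hfin := norm_setIntegral_le_of_norm_le_const (measure_DT_lt_top S)
      fun t ht => hinner t (subset_closure ht)
    refine hfin.trans (le_of_eq ?_)
    rw [hB]
    ring

end Geometric

end Summit.Ventures.HodgeRepro.Tier4.Line4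

end
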